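import Literature.AlgebraicGeometry.Motives.FiberNetSmoothFibres
import Literature.AlgebraicGeometry.HodgeTheory.HyperplaneSectionMonodromySmoothLocus
import Literature.AlgebraicGeometry.HodgeTheory.TopDegreeClasses
import Literature.AlgebraicGeometry.HodgeTheory.IsoTransport
import Literature.AlgebraicGeometry.HodgeTheory.MotivatedClassesDeformation
import Literature.AlgebraicGeometry.Motives.ComplexPointsEhresmann
import HarnessLib

/-!
# Smooth projective families over an open; irreducibility of the smooth fibres (Ehresmann); fibres of surjective closed immersions

Topic `Literature/AlgebraicGeometry/Motives` (theorems only, generic tools for families over `ℂ`):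

* `isSmoothProjectiveFamily_snd_openSubschemeOverι` — a proper family smooth over an open `V` with
  smooth projective fibres there restricts to a smooth projective family over `V`;
* `nonempty_homeomorph_complexPoints_fiberOver`, `geometricallyIrreducible_fiberOver_of_connectedSpace`,
  `connectedSpace_complexPoints_of_iso` — Ehresmann over the connected smooth locus: all fibres have
  homeomorphic complex points, so irreducibility of the smooth fibres spreads from one fibre with
  connected complex points;
* `eq_univ_of_closedPoints_subset`, `isPullback_fst_whiskerRight`, `isClosedImmersion_whiskerRight_left`,
  `exists_fiberIso_of_isClosedImmersion_of_surjective` — small tools: closed points are dense, `u ▷ Y` is a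
  base change of `u`, and the fibres of a surjective closed immersion over a common base with reduced
  target fibre are isomorphisms.

## References

* [VoisinHodgeII2003] C. Voisin, Hodge Theory and Complex Algebraic Geometry II, CUP 2003, §2.1.1 and §3.2.2.
* [VoisinHodgeI2002] C. Voisin, Hodge Theory and Complex Algebraic Geometry I, CUP 2002, §9.1.1 Thm. 9.3.
* [StacksProject] The Stacks Project, Tags 0356, 04XV, 01T6.
-/

noncomputable section

open CategoryTheory CategoryTheory.Limits AlgebraicGeometry TopologicalSpace MonoidalCategory
  CartesianMonoidalCategory
open Literature.AlgebraicGeometry.HodgeTheory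

universe u

namespace Literature.AlgebraicGeometry.Motives.SectionFamily

/-! ### Small tools -/

section Tools

/-- A closed subset of a `ℂ`-scheme locally of finite type which contains every closed point is
everything (the closed points are dense: Jacobson). [folklore] -/
theorem eq_univ_of_closedPoints_subset {Y : SchemeOver ℂ} [LocallyOfFiniteType Y.hom] {C : Set Y.left}
    (hC : IsClosed C) (h : closedPoints Y.left ⊆ C) : C = Set.univ := by
  haveI : JacobsonSpace Y.left := LocallyOfFiniteType.jacobsonSpace Y.hom
  apply Set.eq_univ_of_univ_subset
  rw [← closure_inter_closedPoints (X := Y.left) isClosed_univ, Set.univ_inter]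
  exact closure_minimal h hC

/-- **`X' × Y = (X × Y) ×_X X'`**: for `u : X' ⟶ X` the square `X' ⊗ Y → X'`, `u ▷ Y`, `u`,
`X ⊗ Y → X` is cartesian. [folklore] -/
theorem isPullback_fst_whiskerRight {X X' : SchemeOver ℂ} (u : X' ⟶ X) (Y : SchemeOver ℂ) :
    IsPullback (fst X' Y) (u ▷ Y) u (fst X Y) := by
  -- adapted from `Motives.isPullback_snd_whiskerLeft`
  refine IsPullback.of_isLimit' ⟨(whiskerRight_fst u Y).symm⟩ (PullbackCone.IsLimit.mk _
    (fun c => CartesianMonoidalCategory.lift c.fst (c.snd ≫ snd X Y))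
    (fun c => lift_fst _ _) (fun c => ?_) (fun c m h₁ h₂ => ?_))
  · refine CartesianMonoidalCategory.hom_ext _ _ ?_ ?_
    · rw [Category.assoc, whiskerRight_fst, lift_fst_assoc]
      exact c.condition
    · rw [Category.assoc, whiskerRight_snd, lift_snd]
  · refine CartesianMonoidalCategory.hom_ext _ _ ?_ ?_
    · rw [lift_fst]
      exact h₁
    · rw [lift_snd, ← h₂, Category.assoc, whiskerRight_snd]

/-- `u ▷ Y` is a closed immersion when `u` is (base change, `isPullback_fst_whiskerRight`). [folklore] -/
theorem isClosedImmersion_whiskerRight_left {X X' : SchemeOver ℂ} (u : X' ⟶ X) (Y : SchemeOver ℂ)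
    [IsClosedImmersion u.left] : IsClosedImmersion (u ▷ Y).left :=
  MorphismProperty.of_isPullback (P := @IsClosedImmersion)
    ((isPullback_fst_whiskerRight u Y).map (Over.forget _)) ‹_›

end Tools

/-! ### Smooth projective families over opens; irreducibility of the good fibres (Ehresmann) -/
section Family

/-- **A proper family which is smooth over an open with smooth projective fibres there restricts to a
smooth projective family over that open.** [folklore] -/
theorem isSmoothProjectiveFamily_snd_openSubschemeOverι {m : ℕ} {𝒴 B : SchemeOver ℂ} (π : 𝒴 ⟶ B)
    [IsProper π.left] (V : B.left.Opens) (hsm : SmoothOfRelativeDimension m (π.left ∣_ V))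
    (hfib : ∀ b : ComplexPoints B, b.pt ∈ V → IsSmoothProjective m (fiberOver π b)) :
    IsSmoothProjectiveFamily (familyPullback.snd π (openSubschemeOverι B V)) m := by
  -- adapted from `Theorems.isSmoothProjectiveFamily_pencil_restrict`
  haveI : IsOpenImmersion (openSubschemeOverι B V).left := inferInstanceAs (IsOpenImmersion V.ι)
  have hrange : Set.range (AlgPoints.map (L := ℂ) (openSubschemeOverι B V)) = {P | P.pt ∈ V} := by
    rw [AlgPoints.range_map_of_isOpenImmersion_holds]
    ext P
    change P.pt ∈ V.ι.opensRange ↔ P.pt ∈ V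
    rw [Scheme.Opens.opensRange_ι]
  refine ⟨?_, ?_, fun s' => ?_⟩
  · change SmoothOfRelativeDimension m (pullback.snd π.left V.ι)
    rw [← pullbackRestrictIsoRestrict_hom_morphismRestrict,
      MorphismProperty.cancel_left_of_respectsIso (P := @SmoothOfRelativeDimension m)]
    exact hsm
  · change IsProper (pullback.snd π.left V.ι)
    infer_instance
  · have hmem : (AlgPoints.map (openSubschemeOverι B V) s').pt ∈ V := by
      have h : AlgPoints.map (openSubschemeOverι B V) s' ∈
          Set.range (AlgPoints.map (L := ℂ) (openSubschemeOverι B V)) := ⟨s', rfl⟩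
      rw [hrange] at h
      exact h
    exact (hfib _ hmem).of_iso (fiberOverFamilyPullbackIso π (openSubschemeOverι _ V) s').symm

/-- **All fibres over a connected smooth locus have homeomorphic complex points** (Ehresmann over the
open `V` where the proper `π` is smooth, `exists_trivialisation_of_smoothOfRelativeDimension_morphismRestrict`;
the classes of "homeomorphic fibres" are open in the preconnected `V(ℂ)`,
`nonempty_homeomorph_fibre_of_isPreconnected`; the complex points of the scheme-theoretic fibre are
the topological fibre, `HodgeTheory.fiberHomeomorph`). [cite: VoisinHodgeII2003, §3.2.2]
[cite: VoisinHodgeI2002, §9.1.1 Thm. 9.3] -/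
theorem nonempty_homeomorph_complexPoints_fiberOver {d m : ℕ} {𝒴 B : SchemeOver ℂ} (π : 𝒴 ⟶ B)
    [SmoothOfRelativeDimension m B.hom] [IsSeparated B.hom] [IsSeparated 𝒴.hom] [IsProper π.left]
    [SecondCountableTopology (ComplexPoints 𝒴)] [SecondCountableTopology (ComplexPoints B)]
    (V : B.left.Opens) [SmoothOfRelativeDimension d (π.left ∣_ V)]
    (hV : IsPreconnected {b : ComplexPoints B | b.pt ∈ V}) {b b' : ComplexPoints B} (hb : b.pt ∈ V)
    (hb' : b'.pt ∈ V) : Nonempty (ComplexPoints (fiberOver π b) ≃ₜ ComplexPoints (fiberOver π b')) := by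
  -- adapted from `FiberNet.nonempty_homeomorph_complexPoints_fiber`
  have htriv : ∀ t ∈ {s : ComplexPoints B | s.pt ∈ V},
      ∃ W : Set (ComplexPoints B), IsOpen W ∧ t ∈ W ∧
        ∃ (F : Type) (_ : TopologicalSpace F)
          (φ : ↥W × F ≃ₜ ↥((AlgPoints.map π : ComplexPoints 𝒴 → _) ⁻¹' W)),
          ∀ x, AlgPoints.map π (φ x : ComplexPoints 𝒴) = (x.1 : ComplexPoints _) := by
    intro t ht
    obtain ⟨W, hWo, htW, -, F, _, φ, hφ⟩ :=
      exists_trivialisation_of_smoothOfRelativeDimension_morphismRestrict π V d m t ht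
    exact ⟨W, hWo, htW, F, inferInstance, φ, hφ⟩
  obtain ⟨e⟩ := nonempty_homeomorph_fibre_of_isPreconnected
    (AlgPoints.map π : ComplexPoints 𝒴 → ComplexPoints B) hV htriv hb hb'
  exact ⟨(HodgeTheory.fiberHomeomorph π b).trans (e.trans (HodgeTheory.fiberHomeomorph π b').symm)⟩

/-- **Irreducibility of the good fibres spreads from one.** In the situation of
`nonempty_homeomorph_complexPoints_fiberOver`, if ONE fibre `Y_{b₀}`, `b₀ ∈ V(ℂ)`, has connected
complex points, then every fibre `Y_b`, `b ∈ V(ℂ)`, which is smooth of dimension `d` is geometrically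
irreducible (connected complex points + smooth, `geometricallyIrreducible_of_connectedSpace_complexPoints`).
[cite: VoisinHodgeII2003, §3.2.2] -/
theorem geometricallyIrreducible_fiberOver_of_connectedSpace {d m : ℕ} {𝒴 B : SchemeOver ℂ} (π : 𝒴 ⟶ B)
    [SmoothOfRelativeDimension m B.hom] [IsSeparated B.hom] [IsSeparated 𝒴.hom] [IsProper π.left]
    [SecondCountableTopology (ComplexPoints 𝒴)] [SecondCountableTopology (ComplexPoints B)]
    (V : B.left.Opens) [SmoothOfRelativeDimension d (π.left ∣_ V)]
    (hV : IsPreconnected {b : ComplexPoints B | b.pt ∈ V}) {b₀ : ComplexPoints B} (hb₀ : b₀.pt ∈ V)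
    [ConnectedSpace (ComplexPoints (fiberOver π b₀))] (b : ComplexPoints B) (hb : b.pt ∈ V)
    [SmoothOfRelativeDimension d (fiberOver π b).hom] : GeometricallyIrreducible (fiberOver π b).hom := by
  obtain ⟨e⟩ := nonempty_homeomorph_complexPoints_fiberOver (d := d) (m := m) π V hV hb₀ hb
  haveI : ConnectedSpace (ComplexPoints (fiberOver π b)) := e.surjective.connectedSpace e.continuous
  exact geometricallyIrreducible_of_connectedSpace_complexPoints d

/-- The complex points of a scheme isomorphic (over `ℂ`) to a smooth projective variety form a
connected space (`HodgeTheory.connectedSpace_complexPoints`, `AlgPoints.isHomeomorph_map_of_iso`).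
[folklore] -/
theorem connectedSpace_complexPoints_of_iso {m : ℕ} {Y Z : SchemeOver ℂ} (hZ : IsSmoothProjective m Z)
    (ψ : Z ≅ Y) : ConnectedSpace (ComplexPoints Y) := by
  haveI := HodgeTheory.connectedSpace_complexPoints hZ
  have h := AlgPoints.isHomeomorph_map_of_iso (L := ℂ) ψ
  exact h.surjective.connectedSpace h.continuous

end Family

end Literature.AlgebraicGeometry.Motives.SectionFamily

end
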